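import Mathlib
import HarnessLib
import Literature.Analysis.FluidPDE.SuitableWeak
import Literature.Analysis.FluidPDE.LocalTypeI
import Literature.Analysis.FluidPDE.SpaceTimeRescaling
import Literature.Analysis.FluidPDE.LocalTypeIScaling
import Literature.Analysis.FluidPDE.LocalTypeIReverseZoom
import Literature.Analysis.FluidPDE.SlabPressureNormalization
import Literature.Analysis.FluidPDE.SlabTypeICompactness
import Literature.Analysis.FluidPDE.SereginEpsilonRegularityHolds

/-!
# The final-time singular set of a slab profile with `𝐈 < ⊤` is `ℋ¹`-null
# (stub `stub_finalSliceNull`, line decaying-ancient-bridge of crux RellichScar.ApexLocalisation)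

Caffarelli–Kohn–Nirenberg's Theorem B run AT THE FINAL SLICE `t = 0` of the backward slab
`𝕊 = (-∞, 0) × ℝ³`: for a suitable weak solution `(u, p)` of Navier–Stokes (`ν = 1`, `f = 0`) on
`𝕊` with a weak spatial gradient `G` and finite Albritton–Barker quantity `𝐈 = 𝐈(ℝ³ × ℝ₋) < ⊤`, the
set `Σ₀ = {x | (0, x) is a backward singular point}` has one-dimensional Hausdorff measure zero,
and hence (the radial map `x ↦ ‖x‖` being `1`-Lipschitz, and `μH[1] = volume` on `ℝ`) a
Lebesgue-null set of radii.

The proof is the Vitali covering argument of CKN 1982, §6 / Robinson–Rodrigo–Sadowski 2016,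
Thm. 16.2 (tree: `CKNTheoremB.lean`), with BACKWARD cylinders `Q((0,x), r) ⊆ 𝕊` whose vertices lie
on the final slice, and with the backward one-point dissipation criterion of Seregin 2014, Ch. 6,
Thm. 1.4 (tree: `seregin2014_thm14_holds`) in place of CKN's Proposition 2:

* §1 (`exists_lt_setLIntegral_of_isBackwardSingularPoint`) at a final-slice singular point `(0, x)`
  every scale range `(0, ρ)` contains a radius `r` with `(ε/2) r < ∫∫_{Q((0,x),r)} |G|²`: the
  Navier–Stokes image `ρ u(ρ² t, x + ρ y)` (pressure normalised to unit-ball mean zero,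
  `IsSuitableWeakSolutionOn.sub_unitBallMean_slab`, `isSuitableWeakSolutionInBall_of_slab`) is in
  the class of the criterion, is singular at the origin (`eLpNorm_top_nsZoom`), so the criterion
  fails for it, and `cknE_nsZoom` pulls the large scale back;
* §2 (`setLIntegral_topLayer_ne_top`, `tendsto_setLIntegral_topLayers`) the dissipation of the top
  layers `(-1/(n+1), 0) × B(0, R)` is finite (`E(Q(0, a)) ≤ 𝐈`) and tends to `0` (continuity from
  above of the finite measure `|G|² dvol`);
* §3 (`hausdorffMeasure_null_of_dissipation`) Vitali's lemma in `ℝ³`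
  (`Vitali.exists_disjoint_subfamily_covering_enlargement`): disjoint balls `B(xᵢ, rᵢ)`, `rᵢ < ρ`,
  with `Σ₀ ∩ B(0,R) ⊆ ⋃ B(xᵢ, 3rᵢ)`; the cylinders `Q((0,xᵢ), rᵢ)` are disjoint and lie in the top
  layer, so `Σ 6 rᵢ ≤ 12 ε⁻¹ ∫∫_{layer} |G|² → 0`, and `hausdorffMeasure_le_liminf_tsum` gives
  `μH[1] (Σ₀ ∩ B(0,R)) = 0`;
* §4 the stub: exhaust by `B(0, N)`, then `LipschitzWith.hausdorffMeasure_image_le` and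
  `hausdorffMeasure_real`.

## References

* L. Caffarelli, R. Kohn, L. Nirenberg, Comm. Pure Appl. Math. 35 (1982), §6 (Theorem B).
  [CaffarelliKohnNirenberg1982]
* G. Seregin, *Lecture Notes on Regularity Theory for the Navier–Stokes Equations*, World
  Scientific 2014, Ch. 6, Thm. 1.4. [Seregin2014]
* J. C. Robinson, J. L. Rodrigo, W. Sadowski, *The Three-Dimensional Navier–Stokes Equations*,
  CUP (2016), Thm. 16.2, Lemma 16.8. [RobinsonRodrigoSadowski2016]
* D. Albritton, T. Barker, J. Math. Fluid Mech. 21 (2019), §1, §3. [AlbrittonBarker2019]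
-/

-- the summit and its single sub-problem share the name (CONVENTIONS §1), as in every Theorems file
set_option linter.dupNamespace false

namespace Summit.NavierStokesRegularity.NavierStokesRegularity.Theorems.RellichScarApexLocalisation

open MeasureTheory Set Function Metric Filter Topology TopologicalSpace
open scoped ENNReal NNReal
open Literature.Analysis Literature.Analysis.FluidPDE

local notation "E³" => EuclideanSpace ℝ (Fin 3)

/-! ### §1 The dissipation lower bound at a final-slice singular point -/

/-- Zooming about a point `(0, x₀)` of the final slice maps the backward slab into itself. -/
theorem slab_le_stPreimage_zero {c : ℝ} (hc : 0 < c) (x₀ : E³) :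
    (slab E³ (Iio 0) isOpen_Iio) ≤ stPreimage (c ^ 2) c 0 x₀ (slab E³ (Iio 0) isOpen_Iio) := by
  intro w hw
  have hw' : w.1 < 0 := by simpa [mem_slab] using hw
  show stAffine (c ^ 2) c 0 x₀ w ∈ (slab E³ (Iio 0) isOpen_Iio : Opens (ℝ × E³))
  rw [mem_slab, stAffine_fst]
  show 0 + c ^ 2 * w.1 < 0
  nlinarith [mul_neg_of_pos_of_neg (pow_pos hc 2) hw']

/-- Zooming about a point `(0, x₀)` of the final slice maps the half space `ℝ³ × ℝ₋` onto itself. -/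
theorem stAffine_preimage_lowerHalf_zero {c : ℝ} (hc : 0 < c) (x₀ : E³) :
    stAffine (c ^ 2) c 0 x₀ ⁻¹' (Iio (0 : ℝ) ×ˢ (univ : Set E³)) = Iio (0 : ℝ) ×ˢ univ := by
  ext ⟨s, y⟩
  simp only [mem_preimage, stAffine_apply, mem_prod, mem_Iio, mem_univ, and_true, zero_add]
  constructor
  · intro h; nlinarith [sq_nonneg c, mul_pos (pow_pos hc 2) (show (0:ℝ) < 1 from one_pos)]
  · intro h; nlinarith [pow_pos hc 2]

/-- **Dissipation lower bound at a final-slice singular point** (Seregin 2014, Ch. 6, Thm. 1.4,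
transported by the Navier–Stokes scaling about `(0, x)`). Let `H` be the backward criterion
(the matrix of `seregin2014_thm14` with constant `ε > 0`), `(u, p)` a suitable weak solution on
the backward slab with weak gradient `G` and `𝐈 < ⊤`, and `(0, x)` a backward singular point.
Then every scale range `(0, ρ)` contains a radius `r` with `(ε/2) · r < ∫∫_{Q((0,x), r)} |G|²`:
the image `ρ u(ρ² t, x + ρ y)` with pressure normalised to unit-ball mean zero is a suitable weak
solution in `Q(0, 1)` in the sense of A–B Def. 2.1, singular at the origin, so
`sup_{0<r<1} E(r) ≥ ε` for it, and `E` is scale invariant. -/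
theorem exists_lt_setLIntegral_of_isBackwardSingularPoint {ε : ℝ} (hε : 0 < ε)
    (H : ∀ (v : ℝ → E³ → E³) (q : ℝ → E³ → ℝ), IsSuitableWeakSolutionInBall 1 0 v q →
      (∃ G' : ℝ → E³ → E³ →L[ℝ] E³,
        HasWeakSpatialGradientOn (parabolicCylinderOpens 1 (0 : ℝ × E³)) v G' ∧
        (⨆ r ∈ Ioo (0 : ℝ) 1, cknE r (0 : ℝ × E³) G') < ENNReal.ofReal ε) →
      ∃ ϱ ∈ Ioo (0 : ℝ) 1,
        eLpNorm (uncurry v) ∞ (volume.restrict (parabolicCylinder ϱ (0 : ℝ × E³))) < ∞)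
    {u : ℝ → E³ → E³} {p : ℝ → E³ → ℝ} {G : ℝ → E³ → E³ →L[ℝ] E³}
    (hsw : IsSuitableWeakSolutionOn (slab E³ (Iio 0) isOpen_Iio) 1 0 u p)
    (hwg : HasWeakSpatialGradientOn (slab E³ (Iio 0) isOpen_Iio) u G)
    (hI : typeIBound (Iio (0 : ℝ) ×ˢ univ) u p G < ⊤)
    {x : E³} (hx : IsBackwardSingularPoint u ((0 : ℝ), x)) {ρ : ℝ} (hρ : 0 < ρ) :
    ∃ r : ℝ, 0 < r ∧ r < ρ ∧ ENNReal.ofReal (ε / 2) * ENNReal.ofReal r <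
      ∫⁻ w in parabolicCylinder r ((0 : ℝ), x), ENNReal.ofReal (frobeniusNormSq (G w.1 w.2)) := by
  -- the zoomed triple about `(0, x)` with factor `ρ`
  set v : ℝ → E³ → E³ := ρ • stPull (ρ ^ 2) ρ 0 x u with hv
  set q : ℝ → E³ → ℝ := ρ ^ 2 • stPull (ρ ^ 2) ρ 0 x p with hq
  set K : ℝ → E³ → E³ →L[ℝ] E³ := ρ ^ 2 • stPull (ρ ^ 2) ρ 0 x G with hK
  have hle := slab_le_stPreimage_zero hρ x
  have hswv : IsSuitableWeakSolutionOn (slab E³ (Iio 0) isOpen_Iio) 1 0 v q :=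
    (zoom_isSuitableWeakSolutionOn hsw hρ 0 x).of_le hle
  have hwgv : HasWeakSpatialGradientOn (slab E³ (Iio 0) isOpen_Iio) v K :=
    (zoom_hasWeakSpatialGradientOn hwg hρ 0 x).mono hle
  have hIv : typeIBound (Iio (0 : ℝ) ×ˢ univ) v q K = typeIBound (Iio (0 : ℝ) ×ˢ univ) u p G := by
    conv_lhs => rw [← stAffine_preimage_lowerHalf_zero hρ x]
    exact typeIBound_nsZoom hρ 0 x _ u p G
  have h0' : stAffine (ρ ^ 2) ρ 0 x (0 : ℝ × E³) = ((0 : ℝ), x) := by simp [stAffine]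
  -- normalise the pressure to unit-ball mean zero
  set qn : ℝ → E³ → ℝ := fun t y => q t y - ⨍ y' in ball (0 : E³) 1, q t y' with hqn
  have hswn : IsSuitableWeakSolutionOn (slab E³ (Iio 0) isOpen_Iio) 1 0 v qn :=
    hswv.sub_unitBallMean_slab
  have hIn : typeIBound (Iio (0 : ℝ) ×ˢ univ) v qn K ≠ ⊤ := by
    rw [hqn, typeIBound_sub_unitBallMean hswv.distributional.2.2.1, hIv]
    exact hI.ne
  have hmean : ∀ t, ⨍ y in ball (0 : E³) 1, qn t y = 0 := fun t =>
    unitBallMean_sub_unitBallMean q t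
  have hball : IsSuitableWeakSolutionInBall 1 0 v qn :=
    isSuitableWeakSolutionInBall_of_slab hswn hwgv hIn hmean le_rfl
  have hwg1 : HasWeakSpatialGradientOn (parabolicCylinderOpens 1 (0 : ℝ × E³)) v K :=
    hwgv.mono (parabolicCylinderOpens_le_slab 1 le_rfl)
  -- the image is singular at the origin, so the criterion fails for it
  have hsup : ENNReal.ofReal ε ≤ ⨆ r ∈ Ioo (0 : ℝ) 1, cknE r (0 : ℝ × E³) K := by
    refine not_lt.1 fun hlt => ?_
    obtain ⟨ϱ, hϱ, hfin⟩ := H v qn hball ⟨K, hwg1, hlt⟩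
    have e := eLpNorm_top_nsZoom hρ 0 x ϱ (0 : ℝ × E³) u
    rw [← hv, h0', hx (ρ * ϱ) (mul_pos hρ hϱ.1),
      ENNReal.mul_top (ENNReal.ofReal_pos.2 hρ).ne'] at e
    exact hfin.ne e
  -- a scale `r ∈ (0, 1)` of the image with `ε/2 < E(r)`, pulled back
  have hε2 : ENNReal.ofReal (ε / 2) < ⨆ r ∈ Ioo (0 : ℝ) 1, cknE r (0 : ℝ × E³) K :=
    lt_of_lt_of_le ((ENNReal.ofReal_lt_ofReal_iff hε).2 (by linarith)) hsup
  obtain ⟨r, hr, hlt⟩ := lt_biSup_iff.1 hε2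
  rw [hK, cknE_nsZoom hρ hr.1 0 x 0 G, h0'] at hlt
  refine ⟨ρ * r, mul_pos hρ hr.1, mul_lt_of_lt_one_right hρ hr.2, ?_⟩
  unfold cknE at hlt
  have hR0 : ENNReal.ofReal (ρ * r) ≠ 0 := (ENNReal.ofReal_pos.2 (mul_pos hρ hr.1)).ne'
  rw [mul_comm]
  exact not_le.1 fun h => (not_le.2 hlt) ((ENNReal.inv_mul_le_iff hR0 ENNReal.ofReal_ne_top).2 h)

/-! ### §2 The dissipation of the top layers of the slab -/

/-- **The dissipation of a top layer is finite**: `∫∫_{(-1,0) × B(0, N+1)} |G|² < ∞` when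
`𝐈 < ⊤` (the layer lies in `Q(0, N+1) ⊆ ℝ³ × ℝ₋`, and `E(Q(0, N+1)) ≤ 𝐈`). -/
theorem setLIntegral_topLayer_ne_top {u : ℝ → E³ → E³} {p : ℝ → E³ → ℝ}
    {G : ℝ → E³ → E³ →L[ℝ] E³} (hI : typeIBound (Iio (0 : ℝ) ×ˢ univ) u p G < ⊤) (N : ℕ) :
    ∫⁻ w in Ioo (-1 : ℝ) 0 ×ˢ ball (0 : E³) ((N : ℝ) + 1),
      ENNReal.ofReal (frobeniusNormSq (G w.1 w.2)) ≠ ⊤ := by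
  set a : ℝ := (N : ℝ) + 1 with ha
  have ha1 : 1 ≤ a := by rw [ha]; linarith [N.cast_nonneg (α := ℝ)]
  have ha0 : 0 < a := by positivity
  have hsub : Ioo (-1 : ℝ) 0 ×ˢ ball (0 : E³) a ⊆ parabolicCylinder a (0 : ℝ × E³) := by
    rintro ⟨t, y⟩ ⟨⟨ht1, ht2⟩, hy⟩
    rw [mem_parabolicCylinder]
    refine ⟨⟨?_, by simpa using ht2⟩, by simpa using hy⟩
    simp only [Prod.fst_zero]
    nlinarith
  have hE : cknE a (0 : ℝ × E³) G ≤ typeIBound (Iio (0 : ℝ) ×ˢ univ) u p G :=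
    (cknE_le_abScaledSum (u := u) (p := p)).trans
      (abScaledSum_le_typeIBound ha0 (parabolicCylinder_subset_lowerHalf le_rfl a))
  unfold cknE at hE
  have hra0 : ENNReal.ofReal a ≠ 0 := (ENNReal.ofReal_pos.2 ha0).ne'
  have h := (ENNReal.inv_mul_le_iff hra0 ENNReal.ofReal_ne_top).1 hE
  exact (lt_of_le_of_lt ((lintegral_mono_set hsub).trans h)
    (ENNReal.mul_lt_top ENNReal.ofReal_lt_top hI)).ne

/-- **The dissipation of the top layers tends to zero**: if `∫∫_{(-1,0) × B(0,R)} F < ∞` then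
`∫∫_{(-1/(n+1), 0) × B(0,R)} F → 0` (continuity from above of the finite measure `F dvol` along
the decreasing layers, whose intersection is empty). -/
theorem tendsto_setLIntegral_topLayers {F : ℝ × E³ → ℝ≥0∞} {R : ℝ}
    (hfin : ∫⁻ w in Ioo (-1 : ℝ) 0 ×ˢ ball (0 : E³) R, F w ≠ ⊤) :
    Tendsto (fun n : ℕ => ∫⁻ w in Ioo (-(1 / ((n : ℝ) + 1))) 0 ×ˢ ball (0 : E³) R, F w)
      atTop (𝓝 0) := by
  set A : ℕ → Set (ℝ × E³) := fun n => Ioo (-(1 / ((n : ℝ) + 1))) 0 ×ˢ ball (0 : E³) R with hA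
  have hAm : ∀ n, MeasurableSet (A n) := fun n => measurableSet_Ioo.prod measurableSet_ball
  have hanti : Antitone A := by
    intro m n hmn
    refine prod_mono (Ioo_subset_Ioo ?_ le_rfl) Subset.rfl
    have : (1 / ((n : ℝ) + 1)) ≤ 1 / ((m : ℝ) + 1) :=
      one_div_le_one_div_of_le (by positivity) (by exact_mod_cast Nat.add_le_add_right hmn 1)
    linarith
  have hinter : ⋂ n, A n = ∅ := by
    refine eq_empty_of_forall_notMem fun w hw => ?_
    rw [mem_iInter] at hw
    have h0 : w.1 < 0 := (hw 0).1.2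
    obtain ⟨n, hn⟩ := exists_nat_one_div_lt (neg_pos.2 h0)
    have := (hw n).1.1
    linarith
  have h0 : (volume.withDensity F) (A 0) ≠ ⊤ := by
    rw [withDensity_apply _ (hAm 0)]
    simpa [hA] using hfin
  have h := tendsto_measure_iInter_atTop (μ := volume.withDensity F)
    (fun n => (hAm n).nullMeasurableSet) hanti ⟨0, h0⟩
  rw [hinter, measure_empty] at h
  refine Tendsto.congr (fun n => ?_) h
  rw [Function.comp_apply, withDensity_apply _ (hAm n)]

/-! ### §3 The covering argument at the final slice -/

/-- **The covering estimate at the final slice** (Caffarelli–Kohn–Nirenberg 1982, §6 /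
Robinson–Rodrigo–Sadowski 2016, Thm. 16.2, with backward cylinders hanging from `t = 0`). Let
`F ≥ 0` on `ℝ × ℝ³`, `S ⊆ B(0, R) ⊆ ℝ³`, `0 < l < ∞`, and suppose every `x ∈ S` has, in every
scale range `(0, ρ)`, a radius `r` with `l · r < ∫∫_{Q((0,x), r)} F`, while the top layer
`(-1, 0) × B(0, R+1)` has `∫∫ F < ∞`. Then `μH[1](S) = 0`: at scale `ρₙ = 1/(n+1)` Vitali's lemma
extracts disjoint balls `B(xᵢ, rᵢ)`, `rᵢ < ρₙ`, with `S ⊆ ⋃ B(xᵢ, 3rᵢ)`; the cylinders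
`Q((0,xᵢ), rᵢ)` are disjoint and lie in the layer `(-ρₙ, 0) × B(0, R+1)`, so
`Σᵢ diam B(xᵢ, 3rᵢ) ≤ 6 l⁻¹ ∫∫_{layer} F → 0`, and `μH[1](S) ≤ liminfₙ Σᵢ diam = 0`. -/
theorem hausdorffMeasure_null_of_dissipation {F : ℝ × E³ → ℝ≥0∞} {S : Set E³} {l : ℝ≥0∞}
    (hl0 : l ≠ 0) (hlt : l ≠ ⊤) {R : ℝ} (hS : S ⊆ ball (0 : E³) R)
    (hfreq : ∀ x ∈ S, ∀ ρ : ℝ, 0 < ρ → ∃ r : ℝ, 0 < r ∧ r < ρ ∧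
      l * ENNReal.ofReal r < ∫⁻ w in parabolicCylinder r ((0 : ℝ), x), F w)
    (hfin : ∫⁻ w in Ioo (-1 : ℝ) 0 ×ˢ ball (0 : E³) (R + 1), F w ≠ ⊤) :
    μH[1] S = 0 := by
  -- scales
  set ρ : ℕ → ℝ := fun n => 1 / ((n : ℝ) + 1) with hρ
  have hρ0 : ∀ n, 0 < ρ n := fun n => by positivity
  have hρ1 : ∀ n, ρ n ≤ 1 := fun n => by
    rw [hρ]; dsimp only
    rw [div_le_one (by positivity)]
    linarith [n.cast_nonneg (α := ℝ)]
  -- radii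
  have hrad : ∀ n, ∀ x ∈ S, ∃ r : ℝ, 0 < r ∧ r < ρ n ∧
      l * ENNReal.ofReal r < ∫⁻ w in parabolicCylinder r ((0 : ℝ), x), F w :=
    fun n x hx => hfreq x hx (ρ n) (hρ0 n)
  choose! rad hrad0 hradρ hradl using hrad
  -- Vitali's lemma at each scale
  have hV : ∀ n, ∃ U ⊆ S, U.PairwiseDisjoint (fun x => ball x (rad n x)) ∧
      ∀ a ∈ S, ∃ b ∈ U, (ball a (rad n a) ∩ ball b (rad n b)).Nonempty ∧
        rad n a ≤ 2 * rad n b :=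
    fun n => Vitali.exists_disjoint_subfamily_covering_enlargement (fun x => ball x (rad n x)) S
      (rad n) 2 one_lt_two (fun a ha => (hrad0 n a ha).le) 1
      (fun a ha => (hradρ n a ha).le.trans (hρ1 n)) (fun a ha => ⟨a, mem_ball_self (hrad0 n a ha)⟩)
  choose U hUS hUdisj hUcov using hV
  have hUc : ∀ n, (U n).Countable := fun n =>
    (hUdisj n).countable_of_isOpen (fun x _ => isOpen_ball)
      fun x hx => ⟨x, mem_ball_self (hrad0 n x (hUS n hx))⟩
  haveI : ∀ n, Countable (U n) := fun n => (hUc n).to_subtype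
  -- the covers by the enlarged balls
  set t : ∀ n : ℕ, U n → Set E³ := fun n b => ball (b : E³) (3 * rad n b) with ht
  have hcover : ∀ n, S ⊆ ⋃ b : U n, t n b := by
    intro n a ha
    obtain ⟨b, hb, ⟨c, hca, hcb⟩, hle⟩ := hUcov n a ha
    refine mem_iUnion.2 ⟨⟨b, hb⟩, ?_⟩
    show a ∈ ball b (3 * rad n b)
    rw [mem_ball]
    have h1 : dist a c < rad n a := mem_ball'.1 hca
    have h2 : dist c b < rad n b := mem_ball.1 hcb
    calc dist a b ≤ dist a c + dist c b := dist_triangle _ _ _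
      _ < rad n a + rad n b := add_lt_add h1 h2
      _ ≤ 3 * rad n b := by linarith
  have hdiam' : ∀ n (b : U n), ediam (t n b) ≤ ENNReal.ofReal (6 * rad n b) := by
    intro n b
    refine ediam_le_of_forall_dist_le fun y hy y' hy' => ?_
    have h1 : dist y b < 3 * rad n b := mem_ball.1 hy
    have h2 : dist (b : E³) y' < 3 * rad n b := mem_ball'.1 hy'
    calc dist y y' ≤ dist y b + dist (b : E³) y' := dist_triangle _ _ _
      _ ≤ 6 * rad n b := by linarith
  have hdiam : ∀ n (b : U n), ediam (t n b) ≤ ENNReal.ofReal (6 * ρ n) := fun n b =>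
    (hdiam' n b).trans (ENNReal.ofReal_le_ofReal (by linarith [hradρ n b (hUS n b.2)]))
  -- the diameters tend to zero
  have hr : Tendsto (fun n => ENNReal.ofReal (6 * ρ n)) atTop (𝓝 0) := by
    have h1 : Tendsto ρ atTop (𝓝 0) := tendsto_one_div_add_atTop_nhds_zero_nat
    have h2 : Tendsto (fun n => 6 * ρ n) atTop (𝓝 (6 * 0)) := h1.const_mul 6
    rw [mul_zero] at h2
    simpa using ENNReal.tendsto_ofReal h2
  have hH := Measure.hausdorffMeasure_le_liminf_tsum 1 S (l := atTop)
    (fun n => ENNReal.ofReal (6 * ρ n)) hr t (Eventually.of_forall hdiam)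
    (Eventually.of_forall hcover)
  -- the cover sums are controlled by the dissipation of the top layers
  set e : ℕ → ℝ≥0∞ := fun n =>
    ∫⁻ w in Ioo (-(1 / ((n : ℝ) + 1))) 0 ×ˢ ball (0 : E³) (R + 1), F w with he
  have hsum : ∀ n, ∑' b : U n, ediam (t n b) ^ (1 : ℝ) ≤ 6 * l⁻¹ * e n := by
    intro n
    have hdisjQ : (U n).PairwiseDisjoint fun b => parabolicCylinder (rad n b) ((0 : ℝ), b) := by
      intro a ha b hb hab
      have hd : Disjoint (ball a (rad n a)) (ball b (rad n b)) := hUdisj n ha hb hab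
      exact Set.disjoint_prod.2 (Or.inr hd)
    have hQsub : (⋃ b ∈ U n, parabolicCylinder (rad n b) ((0 : ℝ), b)) ⊆
        Ioo (-(1 / ((n : ℝ) + 1))) 0 ×ˢ ball (0 : E³) (R + 1) := by
      refine iUnion₂_subset fun b hb => ?_
      rintro ⟨s, y⟩ hw
      rw [mem_parabolicCylinder] at hw
      obtain ⟨⟨hs1, hs2⟩, hy⟩ := hw
      have hb0 := hrad0 n b (hUS n hb)
      have hbρ := hradρ n b (hUS n hb)
      have hbR : dist b (0 : E³) < R := mem_ball.1 (hS (hUS n hb))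
      refine ⟨⟨?_, hs2⟩, ?_⟩
      · have h2 : rad n b ^ 2 < ρ n := by nlinarith [hρ1 n]
        simp only at hs1 ⊢
        rw [hρ] at h2
        linarith
      · rw [mem_ball]
        have hy' : dist y b < rad n b := hy
        calc dist y 0 ≤ dist y b + dist b (0 : E³) := dist_triangle _ _ _
          _ < rad n b + R := add_lt_add hy' hbR
          _ ≤ R + 1 := by linarith [hρ1 n]
    calc ∑' b : U n, ediam (t n b) ^ (1 : ℝ)
        ≤ ∑' b : U n, ENNReal.ofReal (6 * rad n b) := by
          refine ENNReal.tsum_le_tsum fun b => ?_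
          rw [ENNReal.rpow_one]
          exact hdiam' n b
      _ ≤ ∑' b : U n, 6 * (l⁻¹ * ∫⁻ w in parabolicCylinder (rad n b) ((0 : ℝ), (b : E³)), F w) := by
          refine ENNReal.tsum_le_tsum fun b => ?_
          rw [ENNReal.ofReal_mul (by norm_num), ENNReal.ofReal_ofNat]
          refine mul_le_mul' le_rfl ?_
          calc ENNReal.ofReal (rad n b) = l⁻¹ * (l * ENNReal.ofReal (rad n b)) := by
                rw [← mul_assoc, ENNReal.inv_mul_cancel hl0 hlt, one_mul]
            _ ≤ l⁻¹ * ∫⁻ w in parabolicCylinder (rad n b) ((0 : ℝ), (b : E³)), F w :=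
                mul_le_mul' le_rfl (hradl n b (hUS n b.2)).le
      _ = 6 * l⁻¹ * ∑' b : U n, ∫⁻ w in parabolicCylinder (rad n b) ((0 : ℝ), (b : E³)), F w := by
          rw [ENNReal.tsum_mul_left, ENNReal.tsum_mul_left, mul_assoc]
      _ = 6 * l⁻¹ * ∫⁻ w in ⋃ b ∈ U n, parabolicCylinder (rad n b) ((0 : ℝ), b), F w := by
          rw [lintegral_biUnion (hUc n)
            (fun b _ => (isOpen_parabolicCylinder _ _).measurableSet) hdisjQ F]
      _ ≤ 6 * l⁻¹ * e n := mul_le_mul' le_rfl (lintegral_mono_set hQsub)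
  -- conclusion
  have he0 : Tendsto e atTop (𝓝 0) := tendsto_setLIntegral_topLayers hfin
  have hb0 : Tendsto (fun n => 6 * l⁻¹ * e n) atTop (𝓝 0) := by
    have h := ENNReal.Tendsto.const_mul he0
      (Or.inr (ENNReal.mul_ne_top (by simp) (ENNReal.inv_ne_top.2 hl0)) :
        (0 : ℝ≥0∞) ≠ 0 ∨ (6 : ℝ≥0∞) * l⁻¹ ≠ ⊤)
    simpa using h
  refine le_antisymm ?_ zero_le
  calc μH[1] S ≤ liminf (fun n => ∑' b : U n, ediam (t n b) ^ (1 : ℝ)) atTop := hH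
    _ ≤ liminf (fun n => 6 * l⁻¹ * e n) atTop := liminf_le_liminf (Eventually.of_forall hsum)
    _ = 0 := hb0.liminf_eq

/-! ### §4 The stub -/

/-- **Final-slice nullity** (Caffarelli–Kohn–Nirenberg 1982 Thm B at the top of the slab: the Vitali
covering argument of `CKNTheoremB.lean` run with BACKWARD cylinders `Q((0,x),r) ⊂ 𝕊` and the
backward dissipation criterion `seregin2014_thm14_holds`, using `E(Q((0,x),r)) ≤ 𝐈 < ⊤` for the
finiteness of the dissipation up to `t = 0`): for a suitable weak slab profile with weak gradient and
`𝐈 < ⊤`, the final-time singular set `{x | (0,x) is a backward singular point}` has one-dimensional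
Hausdorff measure zero, and therefore (1-Lipschitz radial map) a Lebesgue-null set of radii. -/
theorem stub_finalSliceNull :
    ∀ (u : ℝ → E³ → E³) (p : ℝ → E³ → ℝ) (G : ℝ → E³ → E³ →L[ℝ] E³),
      IsSuitableWeakSolutionOn (slab E³ (Iio 0) isOpen_Iio) 1 0 u p →
      HasWeakSpatialGradientOn (slab E³ (Iio 0) isOpen_Iio) u G →
      typeIBound (Iio (0 : ℝ) ×ˢ univ) u p G < ⊤ →
      μH[1] {x : E³ | IsBackwardSingularPoint u ((0 : ℝ), x)} = 0 ∧
      volume ((fun x : E³ => ‖x‖) '' {x : E³ | IsBackwardSingularPoint u ((0 : ℝ), x)}) = 0 := by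
  intro u p G hsw hwg hI
  obtain ⟨ε, hε, H⟩ := seregin2014_thm14_holds
  set S : Set E³ := {x : E³ | IsBackwardSingularPoint u ((0 : ℝ), x)} with hS
  have hl0 : ENNReal.ofReal (ε / 2) ≠ 0 := (ENNReal.ofReal_pos.2 (by positivity)).ne'
  -- each bounded piece is `ℋ¹`-null
  have hpiece : ∀ N : ℕ, μH[1] (S ∩ ball (0 : E³) N) = 0 := fun N =>
    hausdorffMeasure_null_of_dissipation
      (F := fun w => ENNReal.ofReal (frobeniusNormSq (G w.1 w.2))) hl0 ENNReal.ofReal_ne_top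
      (R := (N : ℝ)) inter_subset_right
      (fun x hx ρ hρ => exists_lt_setLIntegral_of_isBackwardSingularPoint hε H hsw hwg hI hx.1 hρ)
      (setLIntegral_topLayer_ne_top hI N)
  have hSU : S ⊆ ⋃ N : ℕ, S ∩ ball (0 : E³) N := by
    intro x hx
    obtain ⟨N, hN⟩ := exists_nat_gt ‖x‖
    exact mem_iUnion.2 ⟨N, hx, mem_ball_zero_iff.2 hN⟩
  have hH : μH[1] S = 0 := measure_mono_null hSU (measure_iUnion_null hpiece)
  refine ⟨hH, ?_⟩
  -- the radial image: `x ↦ ‖x‖` is `1`-Lipschitz and `μH[1] = volume` on `ℝ`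
  have h := (lipschitzWith_one_norm (E := E³)).hausdorffMeasure_image_le zero_le_one S
  rw [hH, mul_zero, nonpos_iff_eq_zero] at h
  rw [← hausdorffMeasure_real]
  exact h

end Summit.NavierStokesRegularity.NavierStokesRegularity.Theorems.RellichScarApexLocalisation
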